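import Summits.ResolutionOfSingularities.ResolutionOfSingularities.Theorems.FrobeniusClosingSteerCore4IsoChartStepFC2
import Literature.AlgebraicGeometry.Resolution.QuadraticTransformsRegular
import Literature.AlgebraicGeometry.Resolution.ArithmeticalThreefoldsLocalFrameDim
import Literature.AlgebraicGeometry.Resolution.CohenMacaulayCatenary
import HarnessLib

/-!
# Crux `Steer` (stmt-16345), chain W4.1 — dictionary piece T2 `chart_step`, file 5/5: ASSEMBLY

OURS (campaign `res-hironaka`, rung L, slot W4.1; helper toward the registered stub `stub_core4Iso` of
reshape r8 of line `switching_dichotomy`; the statement is lead res-L0-w41-lead-1's `DICT-SIGS.lean`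
signature `chart_step` VERBATIM with the abbreviations FC1/FC2/centre inlined; replaces the role of no
printed item; NOT a statement of the manuscript under review; AI-produced). Theses-free.

* `eq_locAtCentre_blowupRing` — the quadratic transform along `O` is the local ring at the centre of the
  chart of ANY exceptional parameter (adapted from the tree's `locAtCentre_blowupRing_eq_of_valuation_eq`).
* `exists_fun_span_eq` — `d` generators for an ideal of span rank `d`.
* `exists_poly_of_residually_algebraic` — the residual algebraicity of `O` over `R` in the polynomial form
  consumed by the tree's dimension formula, from «`κ` algebraic over a subfield `k₀ ⊆ res(R)`».
* `chart_step` (**T2**) — a formal chart `φ` of a regular local `R ⊆ O` dominated by `O` (FC1, FC2,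
  embedding dimension `d`) propagates along the quadratic transform `R₁` of `R` along `O`, at a possibly
  NON-rational centre whose residue field is separable over the perfect `k₀`: there are a chart index `j`,
  a translation `τ ∈ κ^d` and a chart `φ₁` of `R₁` in the same `d` variables with FC1, FC2,
  `φ₁|_R = Φ_{j,τ} ∘ φ` (typed blow-up substitution), `φ₁ x = X_j·unit`, and `R₁`'s centre again of span
  rank `d` (regularity of quadratic transforms + the dimension formula along residually algebraic
  valuations, both in the tree). Pieces: `ChartStepLift` (universal property), `ChartStepPoint` (T2a),
  `ChartStepConstruct` (T2b), `ChartStepFC2` (T2c).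

Sources: S. D. Cutkosky, arXiv:1404.7459 §2; V. Cossart, O. Piltant, arXiv:1412.0868 Prop. 2.7 (frames
after a local blowing up); H. Hauser, S. Perlega, arXiv:1802.05010 §3; folklore. No definitions.
-/

-- layout-mandated namespace `Summit.<Summit>.<Problem>.…` with Summit = Problem (single-conjunct summit)
set_option linter.dupNamespace false

open IsLocalRing MvPowerSeries
open Literature.AlgebraicGeometry.Resolution

namespace Summit.ResolutionOfSingularities.ResolutionOfSingularities.Theorems.SwitchingDichotomy

namespace ChartStep

section Assembly

variable {K : Type*} [Field K] (O : ValuationSubring K)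

/-- The quadratic transform along `O` is the local ring at the centre of the chart of ANY exceptional
parameter `x` (an element of the centre dividing it): `R₁ = (R[𝔪_R/x])_{𝔪_O ∩ R[𝔪_R/x]}`.
(Adapted from the tree's `locAtCentre_blowupRing_eq_of_valuation_eq`, `x/x'` being a unit of `O`.)
[cite: Cutkosky2014, §2.2] -/
theorem eq_locAtCentre_blowupRing {R R₁ : Subring K} [IsLocalRing R]
    (hdom : ∀ a : R, a ∈ maximalIdeal R ↔ O.valuation (a : K) < 1)
    (hQ : IsQuadraticTransformAlong O R R₁) {x : K} (hxR : x ∈ R) (hx0 : x ≠ 0)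
    (hxv : O.valuation x < 1) (hdiv : ∀ y ∈ R, O.valuation y < 1 → y / x ∈ R₁) :
    R₁ = locAtCentre (blowupRing R x) O := by
  obtain ⟨_, x', hx'm, hx'0, hmax, rfl⟩ := hQ.exists_eq_locAtCentre
  have hx'0K : (x' : K) ≠ 0 := fun h => hx'0 (Subtype.ext h)
  have hxm : (⟨x, hxR⟩ : R) ∈ maximalIdeal R := (hdom _).mpr hxv
  -- `v x = v x'`
  have hle : O.valuation x ≤ O.valuation (x' : K) := hmax ⟨x, hxR⟩ hxm
  have hge : O.valuation (x' : K) ≤ O.valuation x := by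
    have h1 : (x' : K) / x ∈ O := (locAtCentre_le ((le_locAtCentre _ O).trans
      (IsLocalBlowup.target_le hQ.isLocalBlowup) |>.trans le_rfl))
        (hdiv x' x'.2 ((hdom x').mp hx'm))
    have h2 : O.valuation ((x' : K) / x) ≤ 1 := (O.valuation_le_one_iff _).mpr h1
    rwa [map_div₀, div_le_one₀ (pos_iff_ne_zero.mpr ((map_ne_zero _).mpr hx0))] at h2
  have hveq : O.valuation x = O.valuation (x' : K) := le_antisymm hle hge
  -- the two charts have the same local ring
  have key : ∀ (a b : K) (ha : a ∈ R) (_ : b ∈ R), (⟨a, ha⟩ : R) ∈ maximalIdeal R → a ≠ 0 → b ≠ 0 →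
      O.valuation a = O.valuation b → blowupRing R a ≤ locAtCentre (blowupRing R b) O := by
    intro a b ha hb ham ha0 hb0 hab
    refine Subring.closure_le.mpr ?_
    rintro z (hz | ⟨y, hy, rfl⟩)
    · exact le_locAtCentre _ O (le_blowupRing R _ hz)
    · have hab1 : O.valuation (a / b) = 1 := by
        rw [map_div₀, hab, div_self ((map_ne_zero _).mpr hb0)]
      refine ⟨(y : K) / b, div_mem_blowupRing _ hy, a / b, div_mem_blowupRing (y := ⟨a, ha⟩) _ ham,
        hab1, ?_⟩
      field_simp
  apply le_antisymm
  · calc locAtCentre (blowupRing R (x' : K)) O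
        ≤ locAtCentre (locAtCentre (blowupRing R x) O) O :=
          locAtCentre_mono O (key x' x x'.2 hxR hx'm hx'0K hx0 hveq.symm)
      _ = locAtCentre (blowupRing R x) O := locAtCentre_locAtCentre _ O
  · calc locAtCentre (blowupRing R x) O
        ≤ locAtCentre (locAtCentre (blowupRing R (x' : K)) O) O :=
          locAtCentre_mono O (key x x' hxR x'.2 hxm hx0 hx'0K hveq)
      _ = locAtCentre (blowupRing R (x' : K)) O := locAtCentre_locAtCentre _ O

/-- A generating family indexed by `Fin d` for an ideal of span rank `d`. [folklore] -/
theorem exists_fun_span_eq {A : Type*} [CommRing A] [IsNoetherianRing A] (I : Ideal A) {d : ℕ}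
    (hd : I.spanFinrank = d) : ∃ u : Fin d → A, Ideal.span (Set.range u) = I := by
  classical
  obtain ⟨s, hs, hspan⟩ := Submodule.FG.exists_span_finset_card_eq_spanFinrank
    ((isNoetherianRing_iff_ideal_fg A).mp ‹_› I)
  rw [hd] at hs
  let e : s ≃ Fin d := Fintype.equivFinOfCardEq (by rw [Fintype.card_coe, hs])
  refine ⟨fun i => ((e.symm i : s) : A), ?_⟩
  have hrange : Set.range (fun i => ((e.symm i : s) : A)) = (s : Set A) := by
    ext a
    constructor
    · rintro ⟨i, rfl⟩; exact (e.symm i).2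
    · intro ha; exact ⟨e ⟨a, Finset.mem_coe.mp ha⟩, by simp⟩
  rw [hrange]
  exact hspan

variable {κ : Type*} [Field κ] (ι : IsLocalRing.ResidueField O →+* κ)

/-- `O` is residually algebraic over `R` in the polynomial form consumed by the tree's dimension
formula (`ringKrullDim_eq_of_isQuadraticTransformAlong`), when `κ ⊇ κ(O)` is algebraic over a subfield
`k₀` all of whose elements are residues of elements of `R`. [folklore] -/
theorem exists_poly_of_residually_algebraic {R : Subring K} (hR : R ≤ O.toSubring) [IsLocalRing R]
    (hdom : ∀ a : R, a ∈ maximalIdeal R ↔ O.valuation (a : K) < 1)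
    (k₀ : Subfield κ) (halg : Algebra.IsAlgebraic k₀ κ)
    (hk₀ : ∀ a ∈ k₀, ∃ r : R, ι (IsLocalRing.residue O (Subring.inclusion hR r)) = a) (y : O) :
    ∃ q : Polynomial R, (∃ i, q.coeff i ∉ maximalIdeal R) ∧
      O.valuation (Polynomial.aeval (y : K) q) < 1 := by
  classical
  haveI := halg
  set b := ι (IsLocalRing.residue O y) with hb
  set P := minpoly k₀ b with hP
  have hmonic : P.Monic := minpoly.monic (Algebra.IsIntegral.isIntegral b)
  choose r hr using fun i => hk₀ ((P.coeff i : k₀) : κ) (P.coeff i).2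
  set N := P.natDegree with hN
  refine ⟨∑ i ∈ Finset.range (N + 1), Polynomial.C (r i) * Polynomial.X ^ i, ⟨N, ?_⟩, ?_⟩
  · -- the top coefficient is a unit: its residue is `1`
    have hcoeff : (∑ i ∈ Finset.range (N + 1), Polynomial.C (r i) * Polynomial.X ^ i).coeff N = r N := by
      rw [Polynomial.finsetSum_coeff]
      simp only [Polynomial.coeff_C_mul_X_pow]
      rw [Finset.sum_ite_eq, if_pos (Finset.self_mem_range_succ N)]
    rw [hcoeff, hdom, ← not_le, not_not, ← not_lt]
    intro hlt
    have h0 : IsLocalRing.residue O (Subring.inclusion hR (r N)) = 0 :=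
      (IsLocalRing.residue_eq_zero_iff _).mpr ((ValuationSubring.valuation_lt_one_iff O _).mpr hlt)
    have := hr N
    rw [h0, map_zero, hN, hmonic.coeff_natDegree] at this
    exact zero_ne_one (this.trans (by simp))
  · -- the value: `q(y) ≡ P(b) = 0` residually
    set Y : O := ∑ i ∈ Finset.range (N + 1), Subring.inclusion hR (r i) * y ^ i with hY
    have hYK : (Polynomial.aeval (y : K)) (∑ i ∈ Finset.range (N + 1),
        Polynomial.C (r i) * Polynomial.X ^ i) = (Y : K) := by
      rw [map_sum, hY, AddSubmonoidClass.coe_finsetSum]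
      refine Finset.sum_congr rfl fun i _ => ?_
      rw [map_mul, map_pow, Polynomial.aeval_C, Polynomial.aeval_X, MulMemClass.coe_mul,
        SubmonoidClass.coe_pow]
      rfl
    rw [hYK, ← ValuationSubring.valuation_lt_one_iff, ← IsLocalRing.residue_eq_zero_iff,
      ← map_eq_zero_iff ι ι.injective, hY, map_sum, map_sum]
    simp only [map_mul, map_pow, hr]
    have halgmap : ∀ c : k₀, algebraMap k₀ κ c = (c : κ) := fun c => rfl
    have := minpoly.aeval k₀ b
    rw [Polynomial.aeval_eq_sum_range, ← hP, ← hN] at this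
    simp only [Algebra.smul_def, halgmap, hb] at this
    exact this

/-- **T2 `chart_step`** (signature of the lead's `DICT-SIGS.lean`, hypotheses FC1/FC2/centre inlined):
a formal chart propagates along one quadratic transform at the centres of `O` (possibly NON-rational),
with the typed blow-up substitution as transition law, `φ₁ x = X_j · unit`, FC1, FC2, and again `d`
generators of the centre. Composition of T2a (`ChartStepPoint`), T2b (`exists_chart_locAtCentre`),
T2c (`map_centre_eq_span_X`) and the tree's dimension formula for quadratic transforms along
residually algebraic valuations. [folklore] -/
theorem chart_step (k₀ : Subfield κ) [PerfectField k₀] (halg : Algebra.IsAlgebraic k₀ κ)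
    (R R₁ : Subring K) (hR : R ≤ O.toSubring) (hR₁ : R₁ ≤ O.toSubring)
    [IsRegularLocalRing R] (hdom : SubringDominates R O.toSubring) (hQ : IsQuadraticTransformAlong O R R₁)
    (hk₀ : ∀ a ∈ k₀, ∃ r : R, ι (IsLocalRing.residue O (Subring.inclusion hR r)) = a)
    (d : ℕ) (hd : (IsLocalRing.maximalIdeal R).spanFinrank = d) (φ : R →+* MvPowerSeries (Fin d) κ)
    (h1 : ∀ r : R, constantCoeff (φ r) = ι (IsLocalRing.residue O (Subring.inclusion hR r)))
    (h2 : Ideal.map φ (Ideal.comap (Subring.inclusion hR) (IsLocalRing.maximalIdeal O)) =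
      Ideal.span (Set.range (X : Fin d → MvPowerSeries (Fin d) κ)))
    (x : K) (hx0 : x ≠ 0) (hxR : x ∈ R) (hxv : O.valuation x < 1)
    (hdiv : ∀ y ∈ R, O.valuation y < 1 → y / x ∈ R₁) :
    ∃ (j : Fin d) (τ : Fin d → κ) (φ₁ : R₁ →+* MvPowerSeries (Fin d) κ),
      (∀ r : R₁, constantCoeff (φ₁ r) = ι (IsLocalRing.residue O (Subring.inclusion hR₁ r))) ∧
      Ideal.map φ₁ (Ideal.comap (Subring.inclusion hR₁) (IsLocalRing.maximalIdeal O)) =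
        Ideal.span (Set.range (X : Fin d → MvPowerSeries (Fin d) κ)) ∧
      (∀ r : R, φ₁ (Subring.inclusion hQ.le r) =
        subst (fun s : Fin d => if s = j then (X j : MvPowerSeries (Fin d) κ) else X j * (X s + C (τ s)))
          (φ r)) ∧
      (∃ w : MvPowerSeries (Fin d) κ, IsUnit w ∧ φ₁ ⟨x, hQ.le hxR⟩ = X j * w) ∧
      (Ideal.comap (Subring.inclusion hR₁) (IsLocalRing.maximalIdeal O)).spanFinrank = d := by
  classical
  have hdom' : ∀ a : R, a ∈ maximalIdeal R ↔ O.valuation (a : K) < 1 :=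
    (subringDominates_valuationSubring_iff hR).mp hdom
  -- `R₁` is the local ring at the centre of the `x`-chart
  have hR₁eq : R₁ = locAtCentre (blowupRing R x) O := eq_locAtCentre_blowupRing O hdom' hQ hxR hx0 hxv hdiv
  subst hR₁eq
  have hB : blowupRing R x ≤ O.toSubring := (le_locAtCentre _ O).trans hR₁
  -- generators of the centre
  have hmc : maximalIdeal R = Ideal.comap (Subring.inclusion hR) (maximalIdeal O) :=
    maximalIdeal_eq_centre O hR hdom'
  obtain ⟨u, hu⟩ := exists_fun_span_eq (maximalIdeal R) hd
  rw [hmc] at hu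
  -- T2a + T2b
  obtain ⟨ξ, j, w, φ₁, hj, hwu, hξ, hw, hP1, hP3, hP4⟩ :=
    exists_chart_locAtCentre O ι hR hdom' φ h1 h2 u hu hxR hx0 hxv hB
  -- T2c
  have hFC2 := map_centre_eq_span_X O ι hR hdom' φ h1 h2 u hu hxR hxv hB k₀ halg hk₀ ξ j hj w hwu hξ hw
    φ₁ hP1 hP3 hP4
  refine ⟨j, fun s => ξ s / ξ j, φ₁, fun r => hP3 r (hR₁ r.2), ?_, fun r => hP1 r _, ⟨w, hwu, ?_⟩, ?_⟩
  · convert hFC2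
  · rw [hP1 ⟨x, hxR⟩ _, hw]
  · -- `d` generators again: regularity + the dimension formula along a residually algebraic `O`
    haveI hreg₁ : IsRegularLocalRing (locAtCentre (blowupRing R x) O) :=
      hQ.isRegularLocalRing_of_isRegularLocalRing ‹_›
    haveI := isRegularRing_of_isRegularLocalRing R
    have hUC : IsUniversallyCatenaryRing R := isUniversallyCatenaryRing_of_isRegularRing' R
    have hdim : ringKrullDim (locAtCentre (blowupRing R x) O) = ringKrullDim R :=
      ringKrullDim_eq_of_isQuadraticTransformAlong O hUC (fun r hr => (hdom' r).mp hr)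
        (exists_poly_of_residually_algebraic O ι hR hdom' k₀ halg hk₀) hQ
    have hmax₁ : Ideal.comap (Subring.inclusion hR₁) (maximalIdeal O) =
        maximalIdeal (locAtCentre (blowupRing R x) O) := (maximalIdeal_locAtCentre hB).symm
    rw [hmax₁]
    have h1' := hreg₁.spanFinrank_maximalIdeal
    rw [hdim, ← IsRegularLocalRing.spanFinrank_maximalIdeal (R := R), hd] at h1'
    exact_mod_cast h1'

end Assembly

end ChartStep

end Summit.ResolutionOfSingularities.ResolutionOfSingularities.Theorems.SwitchingDichotomy
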